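import Summits.QuantumFields.BalabanUV.Beta.AveragingWardRootedStencils

/-!
# `Beta/AveragingLinearGaugeVH` — LG-Q̇, the LINEAR-GAUGE LETTER of the rooted field–multiplier stencil family `vhSAt ρ`

PROVENANCE.  Typed and kernel-checked by an1-g34 as the scratch `HOME/b2b-balaban-beta-an1-g34/lg/LGQdot.lean`
(sha16 ac41bb3895228a7a, RESULT «LG-Q̇ KERNEL-CHECKED» [AN1-G34-LGQ], journal l.28253; memo `lg/LG-LETTER-an1-v1.md`);
statement SHAPE CONFIRMED and GO by the road «BF-x» owner d1-p2 (ruling ρ-g9-12, l.28255); filed verbatim by the cell's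
courier beta-lit1-g32 (planner-role lineages do not file) — every `import`, `def` and `theorem` below is byte-identical
to the scratch; only this module docstring differs (title → tree name, this paragraph).  ABSOLUTE RULE honoured: no
internally-minted statement enters as a cited fact; nothing of Bałaban's is asserted as proved.

HONEST FRAMING.  β sub-cell of the Bałaban audit; END STATEMENT: discharging `FlowStep.BetaPertH` makes Bałaban's UV
stability UNCONDITIONAL inside this package — NOT the continuum limit, NOT Clay.  HONEST DEPENDENCY (verbatim):
«continuum YM on T⁴ ⇐ BetaPertH ∧ nine spine estimates (0/9 proved); BetaPertH ⇐ (D1) ∧ (D4) ∧ CAP+tail; G-an2-4 gates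
asym, D1 and NE2/3/4.»  Everything below is [folklore] finite algebra of our own objects; nothing printed is asserted
(B7 (11) NOT asserted); no `def … : Prop` with a citation; 0 binders discharged.

WHAT.  Road «BF-x» FINDING F-g9-1 (3) asks the stencil owners for the linear-gauge letters `Σ_{u′} X κ″ u′ = [C_κ″, X₀]`.
For `X = Q̇ =` an1's `vhSAt ρ d L` this is a COROLLARY of the landed local law (S-V)ρ
`AveragingWardRootedStencils.divV_vhSAt_apply` by ONE summation by parts in the varied site (§1, generic for any
finitely supported bond family), plus the finite support of the packed stencil in its background bond (§2):
§3 `tsum_vhSAt_eq` / `hasSum_vhSAt` — `Σ_{u′} vhSAt ρ d L rfl κ″ u′ x z a b = ((legSite ρ z b) κ″ − (legSite ρ x a) κ″) ·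
mfNeg (linSymAt ρ L) x z a b`, and the commutator form `… = conjV (mfNeg (linSymAt ρ L)) (diagK (coordSym ρ κ″))`.
The multiplier leg packed at the fine image `z = L·y` acts at the ROOT, coefficient `(L·y + ρ)_κ″` («root offset»).
-/

open Finset
open Literature.MathematicalPhysics.QuantumFieldTheory.Balaban1983to89
open Literature.MathematicalPhysics.QuantumFieldTheory.Balaban1983to89.Beta
open AffineAveraging AveragingContours TransportedContourVariables AveragingHessianKernels AveragingWardJets
  AveragingContoursRooted AveragingHessianKernelsRooted
open Summit.QuantumFields.BalabanUV.Beta.AveragingWardRooted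
open Summit.QuantumFields.BalabanUV.Beta.AveragingWardRootedStencils

noncomputable section

open ExpKernelCalculus (MKer comp)
open OneStepResolventKernel (Fib)
open StepJetData (mfNeg mfNeg_inl_inl mfNeg_inl_inr mfNeg_inr_inl mfNeg_inr_inr)
open KernelWard (divV)
open AveragingWardStencils (b6UnitVec_eq)
open Summit.QuantumFields.BalabanUV.Beta.ChartConjugation (conjV)
open Summit.QuantumFields.BalabanUV.Beta.BorderedHessian (diagK diagK_apply conjV_diagK_apply)

namespace Summit.QuantumFields.BalabanUV.Beta.LinearGaugeVH

/-! ## §1 Summation by parts against a linear gauge function (generic, finitely supported bond families) -/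

section SBP

variable {D : ℕ}

/-- [folklore] A function vanishing off a finset is summable. -/
theorem summable_of_finsupp {g : (Fin D → ℤ) → ℝ} (S : Finset (Fin D → ℤ)) (hg : ∀ u, u ∉ S → g u = 0) :
    Summable g := summable_of_ne_finset_zero (s := S) (fun u hu => hg u hu)

/-- [folklore] **LINEAR-GAUGE SUMMATION BY PARTS**, scalar form: if every `g μ` vanishes off the finset `S`, then
`Σ_u u_κ · Σ_μ (g μ (u − e_μ) − g μ u) = Σ_u g κ u` (the gauge function `λ(u) = u_κ = Σ_y y_κ δ_y`; the weights
telescope to `(e_μ)_κ = [μ = κ]`). -/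
theorem tsum_coord_mul_div (g : Fin D → (Fin D → ℤ) → ℝ) (S : Finset (Fin D → ℤ))
    (hg : ∀ μ u, u ∉ S → g μ u = 0) (κ : Fin D) :
    ∑' u : Fin D → ℤ, (u κ : ℝ) * ∑ μ, (g μ (u - B6BondElimination.unitVec μ) - g μ u)
      = ∑' u : Fin D → ℤ, g κ u := by
  classical
  -- abbreviations
  set e : Fin D → (Fin D → ℤ) := B6BondElimination.unitVec with he
  -- each shifted piece is summable (supported on `S + e_μ`), each unshifted piece on `S`
  have hsh : ∀ μ, Summable fun u : Fin D → ℤ => (u κ : ℝ) * g μ (u - e μ) := by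
    intro μ
    refine summable_of_finsupp (S.image fun v => v + e μ) fun u hu => ?_
    have : u - e μ ∉ S := by
      intro h; exact hu (Finset.mem_image.mpr ⟨u - e μ, h, by simp⟩)
    simp [hg μ _ this]
  have hun : ∀ μ, Summable fun u : Fin D → ℤ => (u κ : ℝ) * g μ u := by
    intro μ
    exact summable_of_finsupp S fun u hu => by simp [hg μ u hu]
  have hgs : ∀ μ, Summable fun u : Fin D → ℤ => g μ u := fun μ => summable_of_finsupp S (hg μ)
  -- reindex the shifted piece: `Σ_u u_κ g μ (u − e_μ) = Σ_v (v + e_μ)_κ g μ v`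
  have hre : ∀ μ, ∑' u : Fin D → ℤ, (u κ : ℝ) * g μ (u - e μ)
      = ∑' v : Fin D → ℤ, ((v κ : ℝ) + (e μ κ : ℝ)) * g μ v := by
    intro μ
    have := (Equiv.addRight (e μ)).tsum_eq (fun u : Fin D → ℤ => (u κ : ℝ) * g μ (u - e μ))
    rw [← this]
    refine tsum_congr fun v => ?_
    simp [Equiv.coe_addRight, Pi.add_apply, Int.cast_add]
  -- expand and compute
  calc ∑' u : Fin D → ℤ, (u κ : ℝ) * ∑ μ, (g μ (u - e μ) - g μ u)
      = ∑' u : Fin D → ℤ, ∑ μ, ((u κ : ℝ) * g μ (u - e μ) - (u κ : ℝ) * g μ u) := by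
        refine tsum_congr fun u => ?_
        rw [Finset.mul_sum]
        refine Finset.sum_congr rfl fun μ _ => by ring
    _ = ∑ μ, ∑' u : Fin D → ℤ, ((u κ : ℝ) * g μ (u - e μ) - (u κ : ℝ) * g μ u) := by
        rw [Summable.tsum_finsetSum (fun μ _ => (hsh μ).sub (hun μ))]
    _ = ∑ μ, (∑' v : Fin D → ℤ, (e μ κ : ℝ) * g μ v) := by
        refine Finset.sum_congr rfl fun μ _ => ?_
        rw [Summable.tsum_sub (hsh μ) (hun μ), hre μ]
        have hsplit : ∑' v : Fin D → ℤ, ((v κ : ℝ) + (e μ κ : ℝ)) * g μ v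
            = ∑' v : Fin D → ℤ, (v κ : ℝ) * g μ v + ∑' v : Fin D → ℤ, (e μ κ : ℝ) * g μ v := by
          rw [← Summable.tsum_add (hun μ) ((hgs μ).mul_left _)]
          exact tsum_congr fun v => by ring
        rw [hsplit]; ring
    _ = ∑ μ, (e μ κ : ℝ) * ∑' v : Fin D → ℤ, g μ v := by
        refine Finset.sum_congr rfl fun μ _ => tsum_mul_left
    _ = ∑' u : Fin D → ℤ, g κ u := by
        simp [he, B6BondElimination.unitVec_apply, Finset.mem_univ]

/-- [folklore] The same for a bond-indexed KERNEL family, entrywise: `Σ_u u_κ · (divV V u) x z a b = Σ_u (V κ u) x z a b`. -/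
theorem tsum_coord_mul_divV {F : Type*} (V : Fin D → (Fin D → ℤ) → MKer D F) (x z : Fin D → ℤ) (a b : F)
    (S : Finset (Fin D → ℤ)) (hV : ∀ μ u, u ∉ S → V μ u x z a b = 0) (κ : Fin D) :
    ∑' u : Fin D → ℤ, (u κ : ℝ) * divV V u x z a b = ∑' u : Fin D → ℤ, V κ u x z a b := by
  have h := tsum_coord_mul_div (fun μ u => V μ u x z a b) S hV κ
  simpa [KernelWard.divV, Finset.sum_apply, Pi.sub_apply] using h

end SBP

/-! ## §2 Finite support of the packed rooted stencil in its background bond -/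

section Support

variable {d : ℕ}

/-- [folklore] The support box of the coarse site `y` as a finset: `Π_i [L·y_i, L·y_i + 2L − 1]`. -/
def nearBox (L : ℕ) (y : Fin (d + 1) → ℤ) : Finset (Fin (d + 1) → ℤ) :=
  Fintype.piFinset fun i => Finset.Icc ((L : ℤ) * y i) ((L : ℤ) * y i + (2 * L - 1))

/-- [folklore] Membership in `nearBox L y` unfolds to the predicate `Near L y`. -/
theorem mem_nearBox {L : ℕ} {y u : Fin (d + 1) → ℤ} : u ∈ nearBox L y ↔ Near L y u := by
  simp [nearBox, Near, Fintype.mem_piFinset, Finset.mem_Icc]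

/-- [folklore] For an admissible root `ρ = toSite r`, `r ∈ box`, the entry `u′ ↦ vhSAt ρ d L rfl κ′ u′ x z a b` vanishes unless
`u′` lies in the support box of the block of `z` or of the block of `x` (`vhKerAt_eq_zero_right` through the packer). -/
theorem vhSAt_eq_zero_of_not_mem {L : ℕ} {r : Fin (d + 1) → ℕ} (hr : r ∈ box (d + 1) L) (κ' : Fin (d + 1))
    (x z : Fin (d + 1) → ℤ) (a b : Fib d) {u : Fin (d + 1) → ℤ}
    (hu : u ∉ nearBox L (blk L z) ∪ nearBox L (blk L x)) : vhSAt (toSite r) d L rfl κ' u x z a b = 0 := by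
  rw [Finset.mem_union, not_or, mem_nearBox, mem_nearBox] at hu
  rcases a with α | μ <;> rcases b with α' | μ'
  · simp [vhSAt]
  · simp only [vhSAt, packVH_inl_inr]
    split_ifs
    · exact vhKerAt_eq_zero_right hr _ (f' := (κ', u)) hu.1
    · rfl
  · simp only [vhSAt, packVH_inr_inl]
    split_ifs
    · exact vhKerAt_eq_zero_right hr _ (f' := (κ', u)) hu.2
    · rfl
  · simp [vhSAt]

end Support

/-! ## §3 LG-Q̇ -/

section LG

variable {d : ℕ}

/-- [folklore] The symbol of the coordinate generator: each leg weighted by the `κ″`-coordinate OF ITS ACTION SITE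
(`legSite`: a fluctuation leg at its own site, a multiplier leg at the ROOT `z + ρ`). -/
def coordSym (ρ : Fin (d + 1) → ℤ) (κ : Fin (d + 1)) : (Fin (d + 1) → ℤ) → Fib d → ℝ :=
  fun z b => ((legSite ρ z b) κ : ℝ)

/-- [folklore] `Σ_u u_κ · [legSite ρ z b = u] = (legSite ρ z b)_κ`. -/
theorem tsum_coord_mul_legInd (ρ z : Fin (d + 1) → ℤ) (b : Fib d) (κ : Fin (d + 1)) :
    ∑' u : Fin (d + 1) → ℤ, (u κ : ℝ) * legInd ρ u z b = ((legSite ρ z b) κ : ℝ) := by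
  classical
  have : (fun u : Fin (d + 1) → ℤ => (u κ : ℝ) * legInd ρ u z b)
      = fun u => if u = legSite ρ z b then ((legSite ρ z b) κ : ℝ) else 0 := by
    funext u
    by_cases h : u = legSite ρ z b
    · subst h; simp [legInd_apply]
    · have h' : legSite ρ z b ≠ u := fun e => h e.symm
      simp [legInd_apply, h, h']
  rw [this, tsum_ite_eq]

/-- [folklore] **LG-Q̇ (raw placement), `tsum` form**: for `1 ≤ L` and an admissible root `ρ = toSite r`, `r ∈ box`,
`Σ_{u′ ∈ ℤ^{d+1}} vhSAt ρ d L rfl κ″ u′ x z a b = ((legSite ρ z b) κ″ − (legSite ρ x a) κ″) · mfNeg (linSymAt ρ L) x z a b`. -/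
theorem tsum_vhSAt_eq {L : ℕ} (hL : 1 ≤ L) {r : Fin (d + 1) → ℕ} (hr : r ∈ box (d + 1) L) (κ : Fin (d + 1))
    (x z : Fin (d + 1) → ℤ) (a b : Fib d) :
    ∑' u : Fin (d + 1) → ℤ, vhSAt (toSite r) d L rfl κ u x z a b
      = (((legSite (toSite r) z b) κ : ℝ) - ((legSite (toSite r) x a) κ : ℝ)) * mfNeg (linSymAt (toSite r) L) x z a b := by
  classical
  set ρ := toSite r with hρ
  have hsupp : ∀ μ u, u ∉ nearBox L (blk L z) ∪ nearBox L (blk L x) → vhSAt ρ d L rfl μ u x z a b = 0 :=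
    fun μ u hu => vhSAt_eq_zero_of_not_mem hr μ x z a b hu
  rw [← tsum_coord_mul_divV (vhSAt ρ d L) x z a b _ hsupp κ]
  simp_rw [divV_vhSAt_apply hL, ← mul_assoc, mul_sub]
  have h1 : Summable fun u : Fin (d + 1) → ℤ => (u κ : ℝ) * legInd ρ u z b := by
    refine summable_of_finsupp {legSite ρ z b} fun u hu => ?_
    have h' : legSite ρ z b ≠ u := fun e => hu (by simp [e.symm])
    simp [legInd_apply, h']
  have h2 : Summable fun u : Fin (d + 1) → ℤ => (u κ : ℝ) * legInd ρ u x a := by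
    refine summable_of_finsupp {legSite ρ x a} fun u hu => ?_
    have h' : legSite ρ x a ≠ u := fun e => hu (by simp [e.symm])
    simp [legInd_apply, h']
  rw [tsum_mul_right, Summable.tsum_sub h1 h2, tsum_coord_mul_legInd, tsum_coord_mul_legInd]

/-- [folklore] **LG-Q̇, `HasSum` form** (the shape asked in F-g9-1 (3): `HasSum (fun u′ ↦ X κ″ u′ x z a b) (commutator entry)`). -/
theorem hasSum_vhSAt {L : ℕ} (hL : 1 ≤ L) {r : Fin (d + 1) → ℕ} (hr : r ∈ box (d + 1) L) (κ : Fin (d + 1))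
    (x z : Fin (d + 1) → ℤ) (a b : Fib d) :
    HasSum (fun u : Fin (d + 1) → ℤ => vhSAt (toSite r) d L rfl κ u x z a b)
      ((((legSite (toSite r) z b) κ : ℝ) - ((legSite (toSite r) x a) κ : ℝ)) * mfNeg (linSymAt (toSite r) L) x z a b) := by
  rw [← tsum_vhSAt_eq hL hr κ x z a b]
  exact (summable_of_finsupp _ fun u hu => vhSAt_eq_zero_of_not_mem hr κ x z a b hu).hasSum

/-- [folklore] **LG-Q̇, COMMUTATOR FORM** — the (W2)∕(S-V)ρ shape with the local generator `diagK (legInd ρ u)` replaced by the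
COORDINATE generator `diagK (coordSym ρ κ″)`: `Σ_{u′} vhSAt ρ d L rfl κ″ u′ = conjV (mfNeg q¹,ρ) (diagK (coordSym ρ κ″))` entrywise. -/
theorem tsum_vhSAt_eq_conjV {L : ℕ} (hL : 1 ≤ L) {r : Fin (d + 1) → ℕ} (hr : r ∈ box (d + 1) L) (κ : Fin (d + 1))
    (x z : Fin (d + 1) → ℤ) (a b : Fib d) :
    ∑' u : Fin (d + 1) → ℤ, vhSAt (toSite r) d L rfl κ u x z a b
      = conjV (mfNeg (linSymAt (toSite r) L)) (diagK (coordSym (toSite r) κ)) x z a b := by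
  rw [tsum_vhSAt_eq hL hr, conjV_diagK_apply, coordSym, coordSym]; ring

/-- [folklore] **THE ROOT OFFSET, read off**: on the `(inl α, inr μ)` block (fluctuation leg at `x`, multiplier leg packed at the fine
image `z`) the coefficient is `(z + ρ)_κ″ − x_κ″` — the multiplier leg responds at the ROOT of its contours. -/
theorem tsum_vhSAt_inl_inr {L : ℕ} (hL : 1 ≤ L) {r : Fin (d + 1) → ℕ} (hr : r ∈ box (d + 1) L) (κ α μ : Fin (d + 1))
    (x z : Fin (d + 1) → ℤ) :
    ∑' u : Fin (d + 1) → ℤ, vhSAt (toSite r) d L rfl κ u x z (Sum.inl α) (Sum.inr μ)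
      = (((z + toSite r) κ : ℝ) - (x κ : ℝ)) * linSymAt (toSite r) L x z (Sum.inl α) (Sum.inr μ) := by
  rw [tsum_vhSAt_eq hL hr, legSite_inr, legSite_inl, mfNeg_inl_inr]

/-- [folklore] **LG-Q̇, ADAPTED placement** (`mfNeg` on the family, as `S₀` carries node 7a's stencil): the same letter with
`linSymAt` itself on the right. -/
theorem tsum_mfNeg_vhSAt_eq {L : ℕ} (hL : 1 ≤ L) {r : Fin (d + 1) → ℕ} (hr : r ∈ box (d + 1) L) (κ : Fin (d + 1))
    (x z : Fin (d + 1) → ℤ) (a b : Fib d) :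
    ∑' u : Fin (d + 1) → ℤ, mfNeg (vhSAt (toSite r) d L rfl κ u) x z a b
      = (((legSite (toSite r) z b) κ : ℝ) - ((legSite (toSite r) x a) κ : ℝ)) * linSymAt (toSite r) L x z a b := by
  rcases a with α | μ <;> rcases b with α' | μ'
  · simp only [mfNeg_inl_inl]; rw [tsum_vhSAt_eq hL hr, mfNeg_inl_inl]
  · simp only [mfNeg_inl_inr]; rw [tsum_vhSAt_eq hL hr, mfNeg_inl_inr]
  · simp only [mfNeg_inr_inl]; rw [tsum_neg, tsum_vhSAt_eq hL hr, mfNeg_inr_inl]; ring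
  · simp only [mfNeg_inr_inr]; rw [tsum_vhSAt_eq hL hr, mfNeg_inr_inr]

end LG

end Summit.QuantumFields.BalabanUV.Beta.LinearGaugeVH

end
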